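import Literature.MathematicalPhysics.QuantumFieldTheory.Balaban1983to89.B16Sect1AnalyticExt

/-!
# `Balaban1983to89.B16Eq143TildeAverage` — T. Bałaban, *Large field renormalization. II. Localization, exponentiation, and
bounds for the 𝐑 operation*, Commun. Math. Phys. **122** (1989) 355–392 [Balaban1989LargeFieldII], p. 366–367: the
tilde-average `M̃^k(U′)` of the sentence *"We write M^k(𝐔) = M̃^k(U′)M^k(U)"* WITH ITS BODY from [12] = T. Bałaban,
*Averaging operations for lattice gauge theories*, Commun. Math. Phys. **98** (1985) 17–51 [Balaban1985Averaging], (69)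
p. 29, and the displays (1.38), (1.43), (1.44) at that instance

statement-level skeleton of published theorems with citation tags; proofs where landed; nothing here is a claim about
the Yang–Mills mass gap

PDF held: `paper:balaban1989-cmp122-large-field-ii` (journal page = PDF page + 354), pp. 366–367 re-read this session as
text (`lit read … --pages 12-13`); `paper:balaban1985-cmp98-averaging`, p. 29 [PDF 13] read as an image
(`run/shared/lean/pub/pub-balaban/b2b-balaban-ref1/pages/1985-cmp98-averaging/1985-cmp98-averaging-p013-x2.png`).

CITATION HEADER / WHAT IS REPRODUCED (mega-formalization `lit-balaban`, B16 owner r13 gen 103; rows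
`lit-balaban-r13/ROWS-B16.md`): SKELETON rows **B16.Eq1.38, B16.Eq1.43, B16.Eq1.44** (owner audit
`READING-RULE-AUDIT-B16-g100.md` §4: *"Owed: [12] instance"* for the factorisation premise).  [LF-II] p. 366, verbatim:
*"By the definition we have 𝐔 = U′U, where U is a G-valued configuration satisfying the regularity condition
|∂U − 1| < α_{0,k}η², and U′ = exp iηA′ … We write M^k(𝐔) = M̃^k(U′)M^k(U), and M̃^k(U′) = exp iQ̃_k(ηA′) = exp iB̃′,
|B̃′| < O(1)α_{1,k}."*  [12] p. 29, verbatim: *"The same reasoning can be applied to a higher order average Ū^k, where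
U = U′U₀, U₀ is a fixed configuration … (Ũ′)_c = ((U′U₀)‾)_c((U₀)‾)_c⁻¹ (65) … Ũ′^{j+1}_c = ((Ũ′^jŪ₀^j)‾)_c((Ū₀^j)‾)_c⁻¹ (68).
From this inductive definition of the average Ũ′^j, it follows easily that Ũ′^j_b = ((U′U₀)‾^j)_b((Ū₀^j))_b⁻¹, b ⊂ Ω^{(j)}.
(69)"*.  So the `M̃^k(U′)` of [LF-II] (the `k`-th tilde-average of `U′` in the FIXED background `U`) HAS THE BODY (69):
`M̃^k(U′) = M^k(U′U)·(M^k(U))⁻¹` bondwise — and the written factorisation `M^k(𝐔) = M̃^k(U′)M^k(U)` is (69) read backwards.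

The tree's `B16Sect1AnalyticExt.ExtData` (r13 gen 4) carries `M̃^k` as the FREE unary field `Mt` (print suppresses the
background argument, as it suppresses the second argument of `V′_Λ`, cf. `VΛ'138`) and the factorisation as the `Prop`
`Fact138M`, hypothesis of `eq138_with138` ∕ `eq143_with138` (Part C, gen 100).  THIS FILE gives `Mt` the body (69) at the
background slice `U = U₀` ([12]: *"U₀ is a fixed configuration"*): `tildeAvg k U′ U₀ := M^k(U′U₀)·(M^k U₀)⁻¹` on the tree's
`Setup.Averaging.iter` (the cell's concrete ℤ^d twin is r04's `B7Eq92Concrete.tildIter`, same formula over `avgIter`), the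
instance `withMt U₀` (`Mt := tildeAvg k · U₀`, domain restricted to the pairs `(U′, U₀)`), and PROVES there:
`fact138M_withMt` (the factorisation — (69)), hence **(1.38)** `eq138_slice` and **(1.43)** `eq143_slice` with NO
hypothesis at the double instance `(withMt E U₀).with138`, for every background `U₀` (so for every `𝐔 = U′U ∈ dom`,
`eq143_cover`); and **(1.44)** at the same instance with its two maps given their bodies — `M̃^j` in the background
`U₀(U)` by (69) again (`tildeAvgBg`) and the primed two-slot map `U′_{k,Z}(W, X′) := U_{k,Z}(W·M^k U, X′·V_Λ(M^k U))·U₀(U)⁻¹`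
(`UkZprime`, [12] (65)'s `U = U′U₀` split of the extended configuration) — `eq144_slice`, from (1.43).
NOT asserted: the representation `M̃^k(U′) = exp iQ̃_k(ηA′)` and the bound `|B̃′| < O(1)α_{1,k}` ([12] Prop. 6 (164), row
B7.Prop6), nor (1.44)'s *"Ṽ_{j,Z}(V′) is an analytic function … satisfying the bound (1.45)"* (row B16.Eq1.45).
No `sorry`, no axiom, no `Prop`-valued fact.
-/

namespace Literature.MathematicalPhysics.QuantumFieldTheory.Balaban1983to89.B16Eq143TildeAverage

open B16Sect1Backgrounds B16Sect1AnalyticExt GaugeField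

noncomputable section

variable {P : Params} {G : Type*} [GaugeGroup G]

/-! ## §1. [12] (69): the tilde-average of `U′` in the background `U₀` on the tree's averaging family -/

/-- **[12] (69)** p. 29, verbatim: *"Ũ′^j_b = ((U′U₀)‾^j)_b((Ū₀^j))_b⁻¹, b ⊂ Ω^{(j)}"* — the `j`-th tilde-average of `U′`
in the fixed background `U₀`: the `j`-fold average of the product with the `j`-fold averaged background removed, bondwise,
over the tree's averaging family `Setup.Averaging.iter` (= [LF-II] p. 366's `M̃^j(U′)`, background suppressed in print;
concrete ℤ^d twin: `B7Eq92Concrete.tildIter`). [cite: Balaban1985Averaging, (69) p.29] -/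
def tildeAvg (av : ∀ i, Averaging P i G) (j : ℕ) (U' U₀ : GaugeField P 0 G) : GaugeField P j G :=
  mulCfg (Averaging.iter av j (mulCfg U' U₀)) (invCfg (Averaging.iter av j U₀))

/-- (69) unfolded at a bond. [cite: Balaban1985Averaging, (69) p.29] -/
theorem tildeAvg_apply (av : ∀ i, Averaging P i G) (j : ℕ) (U' U₀ : GaugeField P 0 G) (b : PBond P j) :
    tildeAvg av j U' U₀ b = Averaging.iter av j (mulCfg U' U₀) b * (Averaging.iter av j U₀ b)⁻¹ := rfl

/-- **(69) read backwards = the factorisation written on [LF-II] p. 366**, *"M^j(𝐔) = M̃^j(U′)M^j(U)"* for `𝐔 = U′U`: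
`M^j(U′U₀) = M̃^j(U′)·M^j(U₀)` bondwise. [cite: Balaban1985Averaging, (69) p.29] -/
theorem iter_mulCfg_eq_tildeAvg_mul (av : ∀ i, Averaging P i G) (j : ℕ) (U' U₀ : GaugeField P 0 G) :
    Averaging.iter av j (mulCfg U' U₀) = mulCfg (tildeAvg av j U' U₀) (Averaging.iter av j U₀) := by
  rw [tildeAvg, ExtData.mulCfg_mulCfg_invCfg]

/-- At the trivial `U′ = 1` the tilde-average is `1` ([12] p. 29: the averages of `U′` *"with values close to 1"*; here the
exact base point). [cite: Balaban1985Averaging, (69) p.29] -/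
theorem tildeAvg_one (av : ∀ i, Averaging P i G) (j : ℕ) (U₀ : GaugeField P 0 G) :
    tildeAvg av j (fun _ => 1) U₀ = fun _ => 1 := by
  funext b
  have h1 : mulCfg (fun _ => (1 : G)) U₀ = U₀ := by funext c; simp [mulCfg]
  rw [tildeAvg_apply, h1, mul_inv_cancel]

/-! ## §2. The instance `withMt U₀`: `M̃^k` with the body (69), the factorisation PROVED -/

section Slice

variable {av : ∀ i, Averaging P i G} {𝔤 : Type*} [AddCommGroup 𝔤] [Module ℝ 𝔤]
variable (E : B16Sect1AnalyticExt.ExtData P G av 𝔤)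

/-- The data record at the BACKGROUND SLICE `U = U₀` with its free field `Mt = M̃^k` REPLACED by the body (69),
`M̃^k(U′) := M^k(U′U₀)·(M^k U₀)⁻¹`, and the domain restricted to the pairs `𝐔 = U′U₀` of `E.dom` ([12] p. 29: *"U = U′U₀, U₀ is
a fixed configuration"*; [LF-II] p. 366: *"𝐔 = U′U, where U is a G-valued configuration …"*); every other field unchanged.
[cite: Balaban1989LargeFieldII, (1.38) p.366] -/
def withMt (U₀ : GaugeField P 0 G) : B16Sect1AnalyticExt.ExtData P G av 𝔤 :=
  { E with Mt := fun U' => tildeAvg av E.k U' U₀, dom := {UU | UU ∈ E.dom ∧ UU.2 = U₀} }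

/-- The `M̃^k` of `withMt E U₀` is the (69) body (definitional). [cite: Balaban1985Averaging, (69) p.29] -/
@[simp] theorem withMt_Mt (U₀ : GaugeField P 0 G) (U' : GaugeField P 0 G) :
    (withMt E U₀).Mt U' = tildeAvg av E.k U' U₀ := rfl

/-- The domain of the slice: the pairs of `E.dom` with background `U₀`. [cite: Balaban1989LargeFieldII, (1.38) p.366] -/
theorem mem_dom_withMt {U₀ : GaugeField P 0 G} {UU : GaugeField P 0 G × GaugeField P 0 G} :
    UU ∈ (withMt E U₀).dom ↔ UU ∈ E.dom ∧ UU.2 = U₀ := Iff.rfl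

/-- The slices cover the domain: every `𝐔 = U′U ∈ dom` lies in the slice of its own background.
[cite: Balaban1989LargeFieldII, (1.38) p.366] -/
theorem mem_dom_withMt_self {UU : GaugeField P 0 G × GaugeField P 0 G} (hUU : UU ∈ E.dom) :
    UU ∈ (withMt E UU.2).dom := ⟨hUU, rfl⟩

/-- The slice leaves `M^k` untouched (definitional). [cite: Balaban1989LargeFieldII, (1.38) p.366] -/
@[simp] theorem withMt_Mk (U₀ : GaugeField P 0 G) : (withMt E U₀).Mk = E.Mk := rfl

/-- The slice leaves `V ↦ V_Λ(V)` untouched (definitional). [cite: Balaban1989LargeFieldII, (1.38) p.366] -/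
@[simp] theorem withMt_VΛmap (U₀ : GaugeField P 0 G) : (withMt E U₀).VΛmap = E.VΛmap := rfl

/-- The slice leaves the two-slot map `U_{k,Z}(·, ·)` untouched (definitional). [cite: Balaban1989LargeFieldII, (1.39) p.366] -/
@[simp] theorem withMt_UkZ2 (U₀ : GaugeField P 0 G) : (withMt E U₀).UkZ2 = E.UkZ2 := rfl

/-- The slice leaves the extended configuration `U₀(𝐔)` untouched (definitional). [cite: Balaban1989LargeFieldII, (1.43) p.367] -/
@[simp] theorem withMt_U0ext (U₀ : GaugeField P 0 G) : (withMt E U₀).U0ext = E.U0ext := rfl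

/-- The slice leaves `U₀(U)` untouched (definitional). [cite: Balaban1989LargeFieldII, (1.44) p.367] -/
@[simp] theorem withMt_U0real (U₀ : GaugeField P 0 G) : (withMt E U₀).U0real = E.U0real := rfl

/-- The slice leaves the free `V′_Λ` untouched (definitional). [cite: Balaban1989LargeFieldII, (1.38) p.366] -/
@[simp] theorem withMt_VΛ' (U₀ : GaugeField P 0 G) : (withMt E U₀).VΛ' = E.VΛ' := rfl

/-- The slice leaves the (1.38) body `V′_Λ(Ṽ′; V) = V_Λ(Ṽ′V)·V_Λ(V)⁻¹` untouched (definitional).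
[cite: Balaban1989LargeFieldII, (1.38) p.366] -/
@[simp] theorem withMt_VΛ'138 (U₀ : GaugeField P 0 G) : (withMt E U₀).VΛ'138 = E.VΛ'138 := rfl

/-- **The factorisation `M^k(𝐔) = M̃^k(U′)M^k(U)` PROVED at the instance** (it is [12] (69) read backwards): the tree's
hypothesis `Fact138M` of (1.38)/(1.43) holds at `withMt E U₀` for every background `U₀`.
[cite: Balaban1989LargeFieldII, (1.38) p.366] -/
theorem fact138M_withMt (U₀ : GaugeField P 0 G) : (withMt E U₀).Fact138M := by
  intro UU hUU
  obtain ⟨-, h2⟩ := (mem_dom_withMt E).1 hUU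
  show E.Mk (mulCfg UU.1 UU.2) = mulCfg (tildeAvg av E.k UU.1 U₀) (E.Mk UU.2)
  rw [h2]
  exact iter_mulCfg_eq_tildeAvg_mul av E.k UU.1 U₀

/-! ## §3. (1.38) and (1.43) with NO hypothesis at the double instance `(withMt E U₀).with138` -/

/-- **(1.38) at the double instance** — `V′_Λ` with its body (1.38) (`with138`, Part C) AND `M̃^k` with its body (69)
(`withMt`): *"V_Λ(M^k(𝐔)) = V′_Λ(M̃^k(U′))V_Λ(M^k(U))"* holds on the slice with no hypothesis left.
[cite: Balaban1989LargeFieldII, (1.38) p.366] -/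
theorem eq138_slice (U₀ : GaugeField P 0 G) : ((withMt E U₀).with138).Eq138 :=
  (withMt E U₀).eq138_with138 (fact138M_withMt E U₀)

/-- **(1.43) at the double instance**, second member: *"U₀(𝐔) = U_{k,Z}(M^k(𝐔), V_Λ(M^k(𝐔))) =
U_{k,Z}(M̃^k(U′)M^k(U), V′_Λ(M̃^k(U′))V_Λ(M^k(U)))"* for every `𝐔 = U′U₀` of the slice — no hypothesis left
(`eq143_with138` with `Fact138M` DISCHARGED by (69)). [cite: Balaban1989LargeFieldII, (1.43) p.367] -/
theorem eq143_slice (U₀ : GaugeField P 0 G) {UU : GaugeField P 0 G × GaugeField P 0 G}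
    (hUU : UU ∈ (withMt E U₀).dom) :
    E.U0ext UU = E.UkZ2 (mulCfg (tildeAvg av E.k UU.1 U₀) (E.Mk UU.2))
      (mulCfg (E.VΛ'138 (tildeAvg av E.k UU.1 U₀) (E.Mk UU.2)) (E.VΛmap (E.Mk UU.2))) :=
  (withMt E U₀).eq143_with138 (fact138M_withMt E U₀) hUU

/-- **(1.43) on the whole domain**: every `𝐔 = U′U ∈ dom` lies in the slice of its background `U`, so (1.43) holds for
it with `M̃^k(U′) = M^k(U′U)(M^k U)⁻¹` and `V′_Λ` = the (1.38) body. [cite: Balaban1989LargeFieldII, (1.43) p.367] -/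
theorem eq143_cover {UU : GaugeField P 0 G × GaugeField P 0 G} (hUU : UU ∈ E.dom) :
    E.U0ext UU = E.UkZ2 (mulCfg (tildeAvg av E.k UU.1 UU.2) (E.Mk UU.2))
      (mulCfg (E.VΛ'138 (tildeAvg av E.k UU.1 UU.2) (E.Mk UU.2)) (E.VΛmap (E.Mk UU.2))) :=
  eq143_slice E UU.2 (mem_dom_withMt_self E hUU)

/-- The two arguments of `U_{k,Z}` in (1.43) ARE `M^k(𝐔)` and `V_Λ(M^k(𝐔))` (the factorised forms collapse by (69) and
(1.38)): consistency of the two members. [cite: Balaban1989LargeFieldII, (1.43) p.367] -/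
theorem eq143_args_collapse {UU : GaugeField P 0 G × GaugeField P 0 G} (hUU : UU ∈ E.dom) :
    mulCfg (tildeAvg av E.k UU.1 UU.2) (E.Mk UU.2) = E.Mk (mulCfg UU.1 UU.2) ∧
      mulCfg (E.VΛ'138 (tildeAvg av E.k UU.1 UU.2) (E.Mk UU.2)) (E.VΛmap (E.Mk UU.2))
        = E.VΛmap (E.Mk (mulCfg UU.1 UU.2)) := by
  have hM := fact138M_withMt E UU.2 UU (mem_dom_withMt_self E hUU)
  have h38 := eq138_slice E UU.2 UU (mem_dom_withMt_self E hUU)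
  exact ⟨hM.symm, h38.symm⟩

/-! ## §4. (1.44) at the instance: `M̃^j` in the background `U₀(U)` and the primed two-slot map with their bodies -/

/-- **`M̃^j` in the background `U₀(U)`** — [12] (69) once more, now for the `j`-th average of a product `X·U₀(U)` of
scale-`0` configurations: `X ↦ M^j(X·U₀(U))·(M^j(U₀(U)))⁻¹` (print's `M̃^j(·)` in (1.44), background suppressed).
[cite: Balaban1985Averaging, (69) p.29] -/
def tildeAvgBg (j : ℕ) (U : GaugeField P 0 G) (X : GaugeField P 0 G) : GaugeField P j G :=
  tildeAvg av j X (E.U0real U)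

/-- **The primed two-slot map `U′_{k,Z}(W, X′)`** of (1.44): the `U′`-part, in the sense of [12] (65) `U = U′U₀`, of the
extended configuration relative to `U₀(U)` — `U′_{k,Z}(W, X′) := U_{k,Z}(W·M^k U, X′·V_Λ(M^k U))·(U₀(U))⁻¹` (so that
`U_{k,Z}(W·M^kU, X′·V_Λ(M^kU)) = U′_{k,Z}(W, X′)·U₀(U)`). [cite: Balaban1989LargeFieldII, (1.44) p.367] -/
def UkZprime (U : GaugeField P 0 G) (W X' : GaugeField P E.k G) : GaugeField P 0 G :=
  mulCfg (E.UkZ2 (mulCfg W (E.Mk U)) (mulCfg X' (E.VΛmap (E.Mk U)))) (invCfg (E.U0real U))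

/-- The split `U_{k,Z}(W·M^kU, X′·V_Λ(M^kU)) = U′_{k,Z}(W, X′)·U₀(U)` ([12] (65) shape). [cite: Balaban1989LargeFieldII, (1.44) p.367] -/
theorem ukZ2_eq_UkZprime_mul (U : GaugeField P 0 G) (W X' : GaugeField P E.k G) :
    E.UkZ2 (mulCfg W (E.Mk U)) (mulCfg X' (E.VΛmap (E.Mk U))) = mulCfg (UkZprime E U W X') (E.U0real U) := by
  rw [UkZprime, ExtData.mulCfg_mulCfg_invCfg]

/-- **(1.44) at the instance**, p. 367, verbatim: *"From these results it follows also that a jᵗʰ average of the above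
configuration can be represented in the form M^j(U₀(𝐔)) = M̃^j(U′_{k,Z}(M̃^k(U′), V′_Λ(M̃^k(U′))))M^j(U₀(U)) =
Ṽ_{j,Z}(M̃^k(U′))M^j(U₀(U))"* — the tree's `Eq144 j Mtj UkZp` HOLDS on the slice `withMt E U₀` composed with `with138`,
when `M̃^j` and `U′_{k,Z}` carry their bodies `tildeAvgBg j U₀` and `UkZprime U₀`: from (1.43) (`eq143_slice`), the split
`ukZ2_eq_UkZprime_mul` and (69) at scale `j`. [cite: Balaban1989LargeFieldII, (1.44) p.367] -/
theorem eq144_slice (j : ℕ) (U₀ : GaugeField P 0 G) :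
    ((withMt E U₀).with138).Eq144 j (tildeAvgBg E j U₀) (UkZprime E U₀) := by
  intro UU hUU
  obtain ⟨-, h2⟩ := (mem_dom_withMt E).1 hUU
  have h43 := eq143_slice E U₀ hUU
  show Averaging.iter av j (E.U0ext UU) =
    mulCfg (tildeAvg av j (UkZprime E U₀ (tildeAvg av E.k UU.1 U₀)
      (E.VΛ'138 (tildeAvg av E.k UU.1 U₀) (E.Mk UU.2))) (E.U0real U₀)) (Averaging.iter av j (E.U0real UU.2))
  rw [h43, h2, ← iter_mulCfg_eq_tildeAvg_mul, ← ukZ2_eq_UkZprime_mul, ← h2]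

/-- **(1.44) on the whole domain**: every `𝐔 = U′U ∈ dom` lies in the slice of its own background `U`, so the (1.44)
identity holds for it with `M̃^j`, `U′_{k,Z}` read in that background (`eq144_slice` at `U₀ := U`).
[cite: Balaban1989LargeFieldII, (1.44) p.367] -/
theorem eq144_cover (j : ℕ) {UU : GaugeField P 0 G × GaugeField P 0 G} (hUU : UU ∈ E.dom) :
    Averaging.iter av j (E.U0ext UU) =
      mulCfg (((withMt E UU.2).with138).Vt144 (tildeAvgBg E j UU.2) (UkZprime E UU.2)
          (fun W => E.VΛ'138 W (E.Mk UU.2)) (tildeAvg av E.k UU.1 UU.2))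
        (Averaging.iter av j (E.U0real UU.2)) :=
  eq144_slice E j UU.2 UU (mem_dom_withMt_self E hUU)

/-- The defined factor `Ṽ_{j,Z}(W) = M̃^j(U′_{k,Z}(W, V′_Λ(W)))` of (1.44) at the instance, unfolded at the background `U = U₀`:
`Ṽ_{j,Z}(W) = M^j(U_{k,Z}(W·M^kU, V′_Λ(W)·V_Λ(M^kU)))·(M^j(U₀(U)))⁻¹`. [cite: Balaban1989LargeFieldII, (1.44) p.367] -/
theorem vt144_slice_apply (j : ℕ) (U₀ : GaugeField P 0 G) (W : GaugeField P E.k G) :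
    ((withMt E U₀).with138).Vt144 (tildeAvgBg E j U₀) (UkZprime E U₀) (fun W => E.VΛ'138 W (E.Mk U₀)) W
      = mulCfg (Averaging.iter av j (E.UkZ2 (mulCfg W (E.Mk U₀)) (mulCfg (E.VΛ'138 W (E.Mk U₀)) (E.VΛmap (E.Mk U₀)))))
          (invCfg (Averaging.iter av j (E.U0real U₀))) := by
  show tildeAvg av j (UkZprime E U₀ W (E.VΛ'138 W (E.Mk U₀))) (E.U0real U₀) = _
  rw [tildeAvg, ← ukZ2_eq_UkZprime_mul]

end Slice

end

end Literature.MathematicalPhysics.QuantumFieldTheory.Balaban1983to89.B16Eq143TildeAverage
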